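import Summits.QuantumAdvantage.QuantumAdvantage.Theorems.WalkTwoStepFarLocalCount

/-!
# (G♯) local engine — `FarLocal p` PROVED (every prime `p ≥ 5`): the left-split count and the assembly

Cell qa-qnc0, rung (G♯) = item stmt-QuantumAdvantage-23121 `OddPrimeWalk.TwoStepFreeRungFive` (planner qa-qnc0-p2 g24, ask P2-24b,
ROUND-24 §1ter REVISION (h)); prover qn-prover-3 g15.

STATEMENT (`LocalEngine.FarLocal p`, verbatim from the checked skeleton `WalkTwoStepLocalEngineCore.lean`): there is `d₀` such that for
every `M` there are `κ > 0` and `n₀` with: for all `n ≥ n₀`, `c`, two-step free-split strategies `S`, classes `w` and cuts `g` that are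
FAR (`α_g ≠ β_g`, `1 ≤ g < n`, `|g − s_g| ≥ d₀`, `p ≤ s_g ≤ n − p`) and co-observed by `≤ M` splits, at least `κ·#class_w` inputs of the
class have `win u ≠ win (cornerFlip n g u)`.

PROOF (this file + `WalkTwoStepFarLocal{Flip,Blocks,Criterion,CriterionLeft,Count}.lean`).  `U := class_w` is stable under the second
involution `ψ = cornerFlip n s_g`, so `#{u ∈ U : disc u} ≥ ½·#{u ∈ U : disc u ≠ disc (ψ u)}` (`card_discordant_le_two_mul_card_true`,
landed in the skeleton).  The four-point formula reduces `disc u ≠ disc (ψ u)` to block arithmetic on five-block inputs, and the counts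
`count_right` / `count_left` (this file: `count_left`, the mirror image, with the roles of the outer blocks exchanged — the block before the
split now carries the prescribed residue mod `p`, the block after the position is free) give `≥ 2^{n−4}·cZ/(6p)` such inputs, against
`#class_w ≤ 2^n`.  Constants: `d₀ = L₁ + 2` (`L₁` from `Equidist` at modulus `3p`), `κ = cZ/(192 p)`, `n₀ = 0`; the co-observer bound `M`
is not used (as predicted by the planner's REVISION (h)).  `farLocal_of_prime`, `farLocal_five : FarLocal 5`.

With `sparsePinned_five` (landed) this leaves `DensePinned 5` as the ONLY open hypothesis of `twoStepFreeRungFive_of`.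
WHAT THIS IS NOT: `DensePinned` is untouched, so (G♯) / item 23121 is not yet closed; nothing about `LinSel`/R5; separation NOT moved.
-/

namespace Summit.QuantumAdvantage.AdviceFreeQNC0.LocalEngine

open Finset Classical
open Summit.QuantumAdvantage.AdviceFreeQNC0.Coset21.RungG (classOf)

/-! ### The five-block count, split to the left -/

section CountLeft

variable {p : ℕ} [Fact p.Prime] {a b d : ℕ}

/-- **Counting lemma, split to the left** (mirror image of `count_right`). -/
theorem count_left (hp5 : 5 ≤ p) (c : ℕ) (S : TwoStep p (a + 2 + (b + 2 + d))) (w : ZMod p)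
    (g h₂ : Fin (a + 2 + (b + 2 + d) + 1)) (hg : g.val = a + 2 + (b + 1)) (hh₂ : h₂.val = a + 1)
    (hsplit : S.s g = h₂.val) (hαβ : S.α g ≠ S.β g)
    (cX : ℝ) (hcX : ∀ x : ZMod p,
      cX * (2 : ℝ) ^ a ≤ (((univ : Finset (Fin a → Bool)).filter fun uX => ((wt uX : ℕ) : ZMod p) = x).card : ℝ))
    (mY : ℝ) (hmY0 : 0 ≤ mY) (hmY : ∀ (y₃ : ℕ) (yp : ZMod p),
      mY ≤ (((univ : Finset (Fin b → Bool)).filter fun uY => wt uY % 3 = y₃ % 3 ∧ ((wt uY : ℕ) : ZMod p) = yp).card : ℝ)) :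
    (2 : ℝ) ^ d * (cX * (2 : ℝ) ^ a) * mY ≤ (((classOf p w : Finset (Fin (a + 2 + (b + 2 + d)) → Bool)).filter fun u =>
        discBit c S g.val u ≠ discBit c S g.val (cornerFlip (a + 2 + (b + 2 + d)) h₂.val u)).card : ℝ) := by
  haveI : NeZero p := ⟨(Fact.out : p.Prime).ne_zero⟩
  -- the predicate counted
  set P : (Fin (a + 2 + (b + 2 + d)) → Bool) → Prop := fun u =>
    ((wt u : ℕ) : ZMod p) = w ∧ discBit c S g.val u ≠ discBit c S g.val (cornerFlip (a + 2 + (b + 2 + d)) h₂.val u) with hP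
  have hcardP : ((classOf p w : Finset (Fin (a + 2 + (b + 2 + d)) → Bool)).filter fun u =>
      discBit c S g.val u ≠ discBit c S g.val (cornerFlip (a + 2 + (b + 2 + d)) h₂.val u)) = univ.filter P := by
    unfold Coset21.RungG.classOf
    rw [Finset.filter_filter]
  -- the specification of the good triples (both corners of type `false`); the free outer block is now `uZ`
  set δ : ZMod p := S.α g - S.β g with hδ
  have hδ0 : δ ≠ 0 := sub_ne_zero.mpr hαβ
  set c₂ : (Fin d → Bool) → Prop := fun uZ =>
    S.s h₂ = a + 2 + (b + 1) ∧ fireAt S h₂ w (w - 1 - ((wt uZ : ℕ) : ZMod p)) ≠ fireAt S h₂ w (w - 1 - ((wt uZ : ℕ) : ZMod p) + 1)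
    with hc₂
  set eZ : (Fin d → Bool) → ZMod p := fun uZ => if c₂ uZ then 2 else 0 with heZ
  set xStar : (Fin d → Bool) → ZMod p := fun uZ => (S.r g + eZ uZ * δ - S.β g * w) * δ⁻¹ with hxStar
  set Xspec : (Fin d → Bool) → (Fin a → Bool) → Prop := fun uZ uX => ((wt uX : ℕ) : ZMod p) = xStar uZ with hXspec
  set y₃ : (Fin d → Bool) → (Fin a → Bool) → ℕ := fun uZ uX =>
    if c₂ uZ then 2 * (c + a + 2 * wt uX + wt uZ + 3) else c + a + b + 2 * wt uX + wt uZ + 6 with hy₃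
  set Yspec : (Fin d → Bool) → (Fin a → Bool) → (Fin b → Bool) → Prop := fun uZ uX uY =>
    wt uY % 3 = y₃ uZ uX % 3 ∧ ((wt uY : ℕ) : ZMod p) = w - 2 - ((wt uX : ℕ) : ZMod p) - ((wt uZ : ℕ) : ZMod p) with hYspec
  -- (1) good triples give counted inputs
  have hgood : ∀ uZ uX uY, Xspec uZ uX → Yspec uZ uX uY → P (blockInput uX false uY false uZ) := by
    intro uZ uX uY hX hY
    simp only [hXspec, hYspec, hxStar] at hX hY
    obtain ⟨hY3, hYp⟩ := hY
    have hW : (((wt uX + 1 + (wt uY + 1 + wt uZ) : ℕ)) : ZMod p) = w := by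
      push_cast; rw [hYp]; ring
    have hN1 : (((wt uX + 1 + wt uY : ℕ)) : ZMod p) = w - 1 - ((wt uZ : ℕ) : ZMod p) := by
      push_cast; rw [hYp]; ring
    have hN2 : (((wt uX + 1 + wt uY + 1 : ℕ)) : ZMod p) = w - 1 - ((wt uZ : ℕ) : ZMod p) + 1 := by
      push_cast; rw [hYp]; ring
    have hX0 : (((wt uX + false.toNat : ℕ)) : ZMod p) = ((wt uX : ℕ) : ZMod p) := by
      simp only [Bool.toNat_false, add_zero]
    -- the split-count relation: `(α−β)·N(s) + β·W = r + e·(α−β)` with `N(s) = |uX|`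
    have hrel : (S.α g - S.β g) * ((wt uX : ℕ) : ZMod p) + S.β g * w = S.r g + eZ uZ * (S.α g - S.β g) := by
      rw [hX, ← hδ]
      have : δ * ((S.r g + eZ uZ * δ - S.β g * w) * δ⁻¹) = S.r g + eZ uZ * δ - S.β g * w := by
        rw [mul_comm, mul_assoc, inv_mul_cancel₀ hδ0, mul_one]
      linear_combination this
    refine ⟨by rw [wt_blockInput]; exact hW, ?_⟩
    by_cases hc : c₂ uZ
    · -- mirror term on: split count at `a₀ + 2`
      have he : eZ uZ = 2 := by simp only [heZ, if_pos hc]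
      have hy : y₃ uZ uX = 2 * (c + a + 2 * wt uX + wt uZ + 3) := by simp only [hy₃, if_pos hc]
      obtain ⟨hc1, hc2⟩ := hc
      refine discBit_ne_left_mirror hp5 c S g h₂ hg hh₂ hsplit hαβ uX false uY false uZ ?_ hc1 ?_ ?_
      · rw [hX0, hW]; rw [he] at hrel; exact hrel
      · rw [hW, hN1, hN2]; exact hc2
      · rw [hy] at hY3; omega
    · -- mirror term off: `g` fires, its liveness flips
      have he : eZ uZ = 0 := by simp only [heZ, if_neg hc]
      have hy : y₃ uZ uX = c + a + b + 2 * wt uX + wt uZ + 6 := by simp only [hy₃, if_neg hc]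
      refine discBit_ne_left_main c S g h₂ hg hh₂ hsplit hαβ uX false uY false uZ ?_ ?_ ?_
      · unfold fireAt
        rw [decide_eq_true_eq, hX0, hW]
        rw [he, zero_mul, add_zero] at hrel
        linear_combination hrel
      · rw [hy] at hY3; omega
      · rw [hW, hN1, hN2]; exact hc
  -- (2) the count of inputs dominates the number of good triples
  have hstep : ∑ uX : Fin a → Bool, ∑ uY : Fin b → Bool, ∑ uZ : Fin d → Bool,
      (if Xspec uZ uX ∧ Yspec uZ uX uY then 1 else 0) ≤ (univ.filter P).card := by
    rw [Finset.card_filter, sum_glue3]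
    refine Finset.sum_le_sum fun uX _ => ?_
    have h1 : ∑ R : Fin (b + 2 + d) → Bool, (if P (glue3 uX (corner false) R) then 1 else 0)
        ≤ ∑ R : Fin (b + 2 + d) → Bool, ∑ κ : Fin 2 → Bool, (if P (glue3 uX κ R) then 1 else 0) :=
      Finset.sum_le_sum fun R _ => Finset.single_le_sum (f := fun κ : Fin 2 → Bool => if P (glue3 uX κ R) then 1 else 0)
        (fun _ _ => Nat.zero_le _) (Finset.mem_univ (corner false))
    refine le_trans ?_ h1
    rw [sum_glue3]
    refine Finset.sum_le_sum fun uY _ => ?_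
    refine Finset.sum_le_sum fun uZ _ => ?_
    have h2 : (if P (glue3 uX (corner false) (glue3 uY (corner false) uZ)) then 1 else 0)
        ≤ ∑ κ' : Fin 2 → Bool, (if P (glue3 uX (corner false) (glue3 uY κ' uZ)) then 1 else 0) :=
      Finset.single_le_sum (f := fun κ' : Fin 2 → Bool => if P (glue3 uX (corner false) (glue3 uY κ' uZ)) then 1 else 0)
        (fun _ _ => Nat.zero_le _) (Finset.mem_univ (corner false))
    refine le_trans ?_ h2
    by_cases hs : Xspec uZ uX ∧ Yspec uZ uX uY
    · have hPu : P (glue3 uX (corner false) (glue3 uY (corner false) uZ)) := hgood uZ uX uY hs.1 hs.2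
      rw [if_pos hs, if_pos hPu]
    · rw [if_neg hs]; exact Nat.zero_le _
  -- (3) evaluate the number of good triples, outer block `uZ` first
  have hXcount : ∀ uZ : Fin d → Bool,
      cX * (2 : ℝ) ^ a * mY ≤ ∑ uX : Fin a → Bool, ∑ uY : Fin b → Bool,
        (if Xspec uZ uX ∧ Yspec uZ uX uY then (1 : ℝ) else 0) := by
    intro uZ
    have h1 : ∀ uX : Fin a → Bool, (if Xspec uZ uX then mY else 0)
        ≤ ∑ uY : Fin b → Bool, (if Xspec uZ uX ∧ Yspec uZ uX uY then (1 : ℝ) else 0) := by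
      intro uX
      by_cases hX : Xspec uZ uX
      · rw [if_pos hX]
        have e : ∑ uY : Fin b → Bool, (if Xspec uZ uX ∧ Yspec uZ uX uY then (1 : ℝ) else 0)
            = (((univ : Finset (Fin b → Bool)).filter fun uY => Yspec uZ uX uY).card : ℝ) := by
          rw [Finset.card_filter]; push_cast
          exact Finset.sum_congr rfl fun uY _ => by simp [hX]
        rw [e]
        exact hmY (y₃ uZ uX) _
      · rw [if_neg hX]
        exact Finset.sum_nonneg fun uY _ => by rw [if_neg (fun h => hX h.1)]
    refine le_trans ?_ (Finset.sum_le_sum fun uX _ => h1 uX)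
    rw [← Finset.sum_filter, Finset.sum_const, nsmul_eq_mul]
    have h2 := hcX (xStar uZ)
    have e : ((univ : Finset (Fin a → Bool)).filter fun uX => Xspec uZ uX)
        = (univ : Finset (Fin a → Bool)).filter fun uX => ((wt uX : ℕ) : ZMod p) = xStar uZ := by rfl
    rw [e]
    nlinarith
  have htotal : (2 : ℝ) ^ d * (cX * (2 : ℝ) ^ a) * mY ≤ ∑ uX : Fin a → Bool, ∑ uY : Fin b → Bool, ∑ uZ : Fin d → Bool,
      (if Xspec uZ uX ∧ Yspec uZ uX uY then (1 : ℝ) else 0) := by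
    have e1 : ∑ uX : Fin a → Bool, ∑ uY : Fin b → Bool, ∑ uZ : Fin d → Bool,
        (if Xspec uZ uX ∧ Yspec uZ uX uY then (1 : ℝ) else 0)
        = ∑ uZ : Fin d → Bool, ∑ uX : Fin a → Bool, ∑ uY : Fin b → Bool,
          (if Xspec uZ uX ∧ Yspec uZ uX uY then (1 : ℝ) else 0) := by
      calc ∑ uX : Fin a → Bool, ∑ uY : Fin b → Bool, ∑ uZ : Fin d → Bool,
            (if Xspec uZ uX ∧ Yspec uZ uX uY then (1 : ℝ) else 0)
          = ∑ uX : Fin a → Bool, ∑ uZ : Fin d → Bool, ∑ uY : Fin b → Bool,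
            (if Xspec uZ uX ∧ Yspec uZ uX uY then (1 : ℝ) else 0) :=
            Finset.sum_congr rfl fun uX _ => Finset.sum_comm
        _ = ∑ uZ : Fin d → Bool, ∑ uX : Fin a → Bool, ∑ uY : Fin b → Bool,
            (if Xspec uZ uX ∧ Yspec uZ uX uY then (1 : ℝ) else 0) := Finset.sum_comm
    have e : (2 : ℝ) ^ d * (cX * (2 : ℝ) ^ a) * mY = ∑ _uZ : Fin d → Bool, cX * (2 : ℝ) ^ a * mY := by
      rw [Finset.sum_const, Finset.card_univ, Fintype.card_fun, Fintype.card_bool, Fintype.card_fin, nsmul_eq_mul]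
      push_cast; ring
    rw [e1, e]
    exact Finset.sum_le_sum fun uZ _ => hXcount uZ
  -- (4) conclude
  rw [hcardP]
  refine htotal.trans ?_
  have := hstep
  exact_mod_cast this

end CountLeft

/-! ### Assembly: `FarLocal p` -/

section Assembly

variable {p : ℕ} [Fact p.Prime]

omit [Fact (Nat.Prime p)] in
/-- From "`disc u ≠ disc (ψ u)` often" to "`disc u` often": the second involution preserves the class. -/
theorem card_disc_ge_half {n : ℕ} (c : ℕ) (S : TwoStep p n) (w : ZMod p) (τ₁ τ₂ : ℕ) :
    (((classOf p w : Finset (Fin n → Bool)).filter fun u =>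
        discBit c S τ₁ u ≠ discBit c S τ₁ (cornerFlip n τ₂ u)).card : ℝ)
      ≤ 2 * (((classOf p w : Finset (Fin n → Bool)).filter fun u =>
        ringWinU c S.y u ≠ ringWinU c S.y (cornerFlip n τ₁ u)).card : ℝ) := by
  have h := card_discordant_le_two_mul_card_true (discBit c S τ₁) (cornerFlip n τ₂) (cornerFlip_cornerFlip n τ₂)
    (classOf p w) (fun u hu => by
      unfold Coset21.RungG.classOf at hu ⊢
      rw [Finset.mem_filter] at hu ⊢
      exact ⟨Finset.mem_univ _, by rw [wt_cornerFlip]; exact hu.2⟩)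
  have e : ((classOf p w : Finset (Fin n → Bool)).filter fun u => discBit c S τ₁ u = true)
      = (classOf p w : Finset (Fin n → Bool)).filter fun u => ringWinU c S.y u ≠ ringWinU c S.y (cornerFlip n τ₁ u) :=
    Finset.filter_congr fun u _ => discBit_eq_true_iff c S τ₁ u
  rw [e] at h
  exact_mod_cast h

omit [Fact (Nat.Prime p)] in
/-- The class has at most `2^n` elements. -/
theorem card_classOf_le {n : ℕ} (w : ZMod p) : ((classOf p w : Finset (Fin n → Bool)).card : ℝ) ≤ (2 : ℝ) ^ n := by
  have h : (classOf p w : Finset (Fin n → Bool)).card ≤ 2 ^ n := by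
    calc (classOf p w : Finset (Fin n → Bool)).card ≤ (univ : Finset (Fin n → Bool)).card := Finset.card_le_univ _
      _ = 2 ^ n := by rw [Finset.card_univ, Fintype.card_fun, Fintype.card_bool, Fintype.card_fin]
  exact_mod_cast h

/-- **`FarLocal p` for every prime `p ≥ 5`** (the far-local lemma of the (G♯) engine). -/
theorem farLocal_of_prime (p : ℕ) [Fact p.Prime] (hp5 : 5 ≤ p) : FarLocal p := by
  haveI : NeZero p := ⟨(Fact.out : p.Prime).ne_zero⟩
  have hp0 : (0 : ℝ) < p := by exact_mod_cast (Fact.out : p.Prime).pos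
  obtain ⟨cZ, hcZ0, hcZ⟩ := exists_residue_count_lower p
  obtain ⟨L₁, hL₁⟩ := exists_crt_count_lower p hp5
  refine ⟨L₁ + 2, fun M => ⟨cZ / (192 * p), by positivity, 0, fun n _ c S w g hFar _ => ?_⟩⟩
  obtain ⟨hαβ, ⟨hg1, hgn⟩, hdist, hps, hsn⟩ := hFar
  -- common final step
  have hmY0 : (0 : ℝ) ≤ (2 : ℝ) ^ (S.s g - g.val - 2) / (6 * p) := by positivity
  suffices hcount : cZ / (96 * p) * (2 : ℝ) ^ n ≤ (((classOf p w : Finset (Fin n → Bool)).filter fun u =>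
      discBit c S g.val u ≠ discBit c S g.val (cornerFlip n (S.s g) u)).card : ℝ) by
    have h1 := card_disc_ge_half c S w g.val (S.s g)
    have h2 := card_classOf_le (n := n) w
    have h3 : cZ / (192 * p) * ((classOf p w : Finset (Fin n → Bool)).card : ℝ) ≤ cZ / (192 * p) * (2 : ℝ) ^ n :=
      mul_le_mul_of_nonneg_left h2 (by positivity)
    have e : cZ / (96 * p) * (2 : ℝ) ^ n = 2 * (cZ / (192 * p) * (2 : ℝ) ^ n) := by ring
    linarith
  rcases hdist with hright | hleft
  · -- split to the RIGHT of the position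
    obtain ⟨a, ha⟩ : ∃ a, g.val = a + 1 := ⟨g.val - 1, by omega⟩
    obtain ⟨b, hb⟩ : ∃ b, S.s g = a + 2 + (b + 1) := ⟨S.s g - a - 3, by omega⟩
    obtain ⟨d, hd⟩ : ∃ d, n = a + 2 + (b + 2 + d) := ⟨n - (a + 2 + (b + 2)), by omega⟩
    have hbL : L₁ ≤ b := by omega
    have hdp : p - 1 ≤ d := by omega
    subst hd
    set h₂ : Fin (a + 2 + (b + 2 + d) + 1) := ⟨a + 2 + (b + 1), by omega⟩ with hh₂def
    have hh₂ : h₂.val = a + 2 + (b + 1) := rfl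
    have hsplit : S.s g = h₂.val := by rw [hh₂, hb]
    have hcnt := count_right hp5 c S w g h₂ ha hh₂ hsplit hαβ cZ (hcZ d hdp) ((2 : ℝ) ^ b / (6 * p)) (by positivity) (hL₁ b hbL)
    rw [hb]
    refine le_trans (le_of_eq ?_) hcnt
    rw [pow_add, pow_add, pow_add, pow_add]
    field_simp
    ring
  · -- split to the LEFT of the position
    obtain ⟨a, ha⟩ : ∃ a, S.s g = a + 1 := ⟨S.s g - 1, by omega⟩
    obtain ⟨b, hb⟩ : ∃ b, g.val = a + 2 + (b + 1) := ⟨g.val - a - 3, by omega⟩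
    obtain ⟨d, hd⟩ : ∃ d, n = a + 2 + (b + 2 + d) := ⟨n - (a + 2 + (b + 2)), by omega⟩
    have hbL : L₁ ≤ b := by omega
    have hap : p - 1 ≤ a := by omega
    subst hd
    set h₂ : Fin (a + 2 + (b + 2 + d) + 1) := ⟨a + 1, by omega⟩ with hh₂def
    have hh₂ : h₂.val = a + 1 := rfl
    have hsplit : S.s g = h₂.val := by rw [hh₂, ha]
    have hcnt := count_left hp5 c S w g h₂ hb hh₂ hsplit hαβ cZ (hcZ a hap) ((2 : ℝ) ^ b / (6 * p)) (by positivity) (hL₁ b hbL)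
    rw [ha]
    refine le_trans (le_of_eq ?_) hcnt
    rw [pow_add, pow_add, pow_add, pow_add]
    field_simp
    ring

/-- **`FarLocal 5`** — the far-local lemma of the (G♯) skeleton at `p = 5`, the hypothesis `h₁` of `twoStepFreeRungFive_of`
(item stmt-QuantumAdvantage-23121). -/
theorem farLocal_five : FarLocal 5 :=
  haveI : Fact (Nat.Prime 5) := ⟨by norm_num⟩
  farLocal_of_prime 5 le_rfl

/-- **(G♯) modulo the dense pinned branch**: with `FarLocal 5` and `SparsePinned 5` proved, the rung item's signature follows from
`DensePinned 5` alone. -/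
theorem twoStepFreeRungFive_of_densePinned (h₃ : DensePinned 5) :
    (∃ θ : ℝ, θ < 1 ∧ ∃ n₀ : ℕ, ∀ n ≥ n₀, ∀ c : ℕ, ∀ y : Fin (n + 1) → (Fin n → Bool) → Bool, (∀ g, ∃ s : ℕ, ∃ α β r : ZMod 5, ∀ u, y g u = decide ((Finset.univ.sum fun i : Fin n => if u i then (if i.val < s then α else β) else 0) = r)) → ((Finset.univ.filter fun u : Fin n → Bool => Summit.QuantumAdvantage.AdviceFreeQNC0.ringWinU c y u = true).card : ℝ) ≤ θ * (2 : ℝ) ^ n) :=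
  twoStepFreeRungFive_of farLocal_five sparsePinned_five h₃

end Assembly

end Summit.QuantumAdvantage.AdviceFreeQNC0.LocalEngine
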